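import Summits.HubbardSuperconductivity.HubbardSuperconductivity.Theorems.LevyLogBootstrapDressHalfFilledPairResolventCertificate
import Literature.MathematicalPhysics.QuantumLattice.HubbardGaugeBound
import Summits.HubbardSuperconductivity.HubbardSuperconductivity.Theorems.SgCorridor.Negative.AnchorFreezeAveraging
import HarnessLib

/-!
# Crux `DressHalfFilled` (stmt-HubbardSuperconductivity-8148, route `LevyLogBootstrap`; shared with route
# `AnisotropyChord`): perturbation of `pairResolvent` in its four arguments and an a-posteriori ground-state enclosure

Support file (`--supports stmt-HubbardSuperconductivity-8148`) for STUB 1 `stub_plaquetteData`, clause (W1) (the Kato-kernel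
window), continuing `…PairResolventSylvester` / `…PairResolventCertificate`. The certificate evaluates
`pairResolvent hH E a b c d` for EXPLICIT vectors; in `plaquetteKernel U` the vectors are `c_i φ`, `c†_i φ` for the two
(abstract, chosen) plaquette ground states `φ`. This file supplies the two generic bridges:

* `pairResolvent_sub₁` … `pairResolvent_sub₄`, `pairResolvent_smul₁` … `pairResolvent_smul₄` — sesquilinearity of the pair
  resolvent (conjugate-linear in `a`, `c`, linear in `b`, `d`); `pairResolvent_perturb_le` — on two blocks with form
  floors `θ₁, θ₂` and `E < θ₁ + θ₂`, `(θ₁+θ₂-E) |T(a,b,c,d) - T(a',b',c',d')| ≤ ‖a-a'‖‖b‖‖c‖‖d‖ + ‖a'‖‖b-b'‖‖c‖‖d‖ +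
  ‖a'‖‖b'‖‖c-c'‖‖d‖ + ‖a'‖‖b'‖‖c'‖‖d-d'‖` (telescoping + `norm_pairResolvent_le`);
* `dressHalfFilled_fermionNormLe` — `‖c_i v‖ ≤ ‖v‖`, `‖c†_i v‖ ≤ ‖v‖` (reusing the landed
  `DeformationLadder.ss_eucNorm_annihilation_mulVec_le` / `SgAnchorFreeze.eucNorm_creation_mulVec_le`);
* `groundState_enclosure` — for a Hermitian `H`, a block `p`, a unit eigenvector `φ` (`Hφ = λ₁φ`, supported on `p`), a
  DEFLATED form floor `λ₂⁻ ‖u‖² ≤ Re⟨u,Hu⟩ + κ |⟨ψ,u⟩|²` on the block (kernel-checkable by the rank-one Gram certificates of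
  `CooperPairDMott…GCWindowAlgebra`) and an explicit block vector `ψ` with energy `Re⟨ψ,Hψ⟩ ≤ ē‖ψ‖²`, residual
  `‖Hψ - ρψ‖ ≤ r` and a floor `λ₁⁻ ≤ λ₁`: the component of `ψ` orthogonal to `φ` has norm `√D` with
  `(λ₂⁻ - λ₁)·D ≤ ‖ψ‖² (ē - λ₁⁻)` (energy step) and `(λ₂⁻ - ρ - κ D)·√D ≤ r` (residual step) — the two-step
  a-posteriori enclosure of a simple ground state (Davis–Kahan type), with `|⟨φ,ψ⟩|² = ‖ψ‖² - D`.

Sources: T. Kato (1966) I-§5.3; C. Davis, W. M. Kahan, SIAM J. Numer. Anal. 7 (1970) 1 (sin Θ theorem; here the elementary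
residual form); Koma–Tasaki, PRL 68 (1992) 3248 (`‖c_i‖ ≤ 1`). No definition and no named fact is introduced.
-/

noncomputable section

set_option linter.dupNamespace false

namespace Summit.HubbardSuperconductivity.HubbardSuperconductivity.Theorems.LevyLogBootstrap

open Matrix Finset Literature.MathematicalPhysics.QuantumLattice
open scoped ComplexOrder

section Generic

variable {m : Type*} [Fintype m] [DecidableEq m]

/-! ### Sesquilinearity of the pair resolvent -/

section Sesq

/-- Difference in the first argument. [folklore] -/
theorem pairResolvent_sub₁ {H : Matrix m m ℂ} (hH : H.IsHermitian) (E : ℝ) (a a' b c d : m → ℂ) :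
    pairResolvent hH E a b c d - pairResolvent hH E a' b c d = pairResolvent hH E (a - a') b c d := by
  simp only [pairResolvent, ← Finset.sum_sub_distrib, star_sub, sub_dotProduct]
  refine Finset.sum_congr rfl fun μ _ => Finset.sum_congr rfl fun ν _ => ?_
  ring

/-- Difference in the second argument. [folklore] -/
theorem pairResolvent_sub₂ {H : Matrix m m ℂ} (hH : H.IsHermitian) (E : ℝ) (a b b' c d : m → ℂ) :
    pairResolvent hH E a b c d - pairResolvent hH E a b' c d = pairResolvent hH E a (b - b') c d := by
  simp only [pairResolvent, ← Finset.sum_sub_distrib, dotProduct_sub]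
  refine Finset.sum_congr rfl fun μ _ => Finset.sum_congr rfl fun ν _ => ?_
  ring

/-- Difference in the third argument. [folklore] -/
theorem pairResolvent_sub₃ {H : Matrix m m ℂ} (hH : H.IsHermitian) (E : ℝ) (a b c c' d : m → ℂ) :
    pairResolvent hH E a b c d - pairResolvent hH E a b c' d = pairResolvent hH E a b (c - c') d := by
  simp only [pairResolvent, ← Finset.sum_sub_distrib, star_sub, sub_dotProduct]
  refine Finset.sum_congr rfl fun μ _ => Finset.sum_congr rfl fun ν _ => ?_
  ring

/-- Difference in the fourth argument. [folklore] -/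
theorem pairResolvent_sub₄ {H : Matrix m m ℂ} (hH : H.IsHermitian) (E : ℝ) (a b c d d' : m → ℂ) :
    pairResolvent hH E a b c d - pairResolvent hH E a b c d' = pairResolvent hH E a b c (d - d') := by
  simp only [pairResolvent, ← Finset.sum_sub_distrib, dotProduct_sub]
  refine Finset.sum_congr rfl fun μ _ => Finset.sum_congr rfl fun ν _ => ?_
  ring

/-- Conjugate-linearity in the first argument. [folklore] -/
theorem pairResolvent_smul₁ {H : Matrix m m ℂ} (hH : H.IsHermitian) (E : ℝ) (x : ℂ) (a b c d : m → ℂ) :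
    pairResolvent hH E (x • a) b c d = star x * pairResolvent hH E a b c d := by
  simp only [pairResolvent, star_smul, smul_dotProduct, smul_eq_mul, Finset.mul_sum]
  refine Finset.sum_congr rfl fun μ _ => Finset.sum_congr rfl fun ν _ => ?_
  ring

/-- Linearity in the second argument. [folklore] -/
theorem pairResolvent_smul₂ {H : Matrix m m ℂ} (hH : H.IsHermitian) (E : ℝ) (x : ℂ) (a b c d : m → ℂ) :
    pairResolvent hH E a (x • b) c d = x * pairResolvent hH E a b c d := by
  simp only [pairResolvent, dotProduct_smul, smul_eq_mul, Finset.mul_sum]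
  refine Finset.sum_congr rfl fun μ _ => Finset.sum_congr rfl fun ν _ => ?_
  ring

/-- Conjugate-linearity in the third argument. [folklore] -/
theorem pairResolvent_smul₃ {H : Matrix m m ℂ} (hH : H.IsHermitian) (E : ℝ) (x : ℂ) (a b c d : m → ℂ) :
    pairResolvent hH E a b (x • c) d = star x * pairResolvent hH E a b c d := by
  simp only [pairResolvent, star_smul, smul_dotProduct, smul_eq_mul, Finset.mul_sum]
  refine Finset.sum_congr rfl fun μ _ => Finset.sum_congr rfl fun ν _ => ?_
  ring

/-- Linearity in the fourth argument. [folklore] -/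
theorem pairResolvent_smul₄ {H : Matrix m m ℂ} (hH : H.IsHermitian) (E : ℝ) (x : ℂ) (a b c d : m → ℂ) :
    pairResolvent hH E a b c (x • d) = x * pairResolvent hH E a b c d := by
  simp only [pairResolvent, dotProduct_smul, smul_eq_mul, Finset.mul_sum]
  refine Finset.sum_congr rfl fun μ _ => Finset.sum_congr rfl fun ν _ => ?_
  ring

end Sesq

/-! ### Perturbation in the four arguments -/

section Perturb

omit [Fintype m] [DecidableEq m] in
/-- Supports are preserved by subtraction. [folklore] -/
theorem support_sub {p : m → Prop} {v w : m → ℂ} (hv : ∀ j, ¬ p j → v j = 0) (hw : ∀ j, ¬ p j → w j = 0) :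
    ∀ j, ¬ p j → (v - w) j = 0 := fun j hj => by
  rw [Pi.sub_apply, hv j hj, hw j hj, sub_zero]

/-- **Perturbation of the pair resolvent in its four arguments** (blocks `p₁ ∋ a, a', b, b'` and
`p₂ ∋ c, c', d, d'`, floors `θ₁, θ₂`, `E < θ₁ + θ₂`):
`(θ₁+θ₂-E) |T(a,b,c,d) - T(a',b',c',d')| ≤ ‖a-a'‖‖b‖‖c‖‖d‖ + ‖a'‖‖b-b'‖‖c‖‖d‖ + ‖a'‖‖b'‖‖c-c'‖‖d‖ + ‖a'‖‖b'‖‖c'‖‖d-d'‖`.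
[folklore] -/
theorem pairResolvent_perturb_le {H : Matrix m m ℂ} (hH : H.IsHermitian) (p₁ p₂ : m → Prop) [DecidablePred p₁]
    [DecidablePred p₂] (hK₁ : ∀ j k, ¬ p₁ j → p₁ k → H j k = 0)
    (hK₂ : ∀ j k, ¬ p₂ j → p₂ k → H j k = 0) {θ₁ θ₂ E : ℝ}
    (hθ₁ : ∀ u : m → ℂ, (∀ j, ¬ p₁ j → u j = 0) → θ₁ * (star u ⬝ᵥ u).re ≤ (star u ⬝ᵥ H *ᵥ u).re)
    (hθ₂ : ∀ u : m → ℂ, (∀ j, ¬ p₂ j → u j = 0) → θ₂ * (star u ⬝ᵥ u).re ≤ (star u ⬝ᵥ H *ᵥ u).re)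
    (hE : E < θ₁ + θ₂) {a a' b b' c c' d d' : m → ℂ}
    (ha : ∀ j, ¬ p₁ j → a j = 0) (ha' : ∀ j, ¬ p₁ j → a' j = 0)
    (hb : ∀ j, ¬ p₁ j → b j = 0) (hb' : ∀ j, ¬ p₁ j → b' j = 0)
    (hc : ∀ j, ¬ p₂ j → c j = 0) (hc' : ∀ j, ¬ p₂ j → c' j = 0)
    (hd : ∀ j, ¬ p₂ j → d j = 0) (hd' : ∀ j, ¬ p₂ j → d' j = 0) :
    (θ₁ + θ₂ - E) * ‖pairResolvent hH E a b c d - pairResolvent hH E a' b' c' d'‖ ≤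
      eucNorm (a - a') * eucNorm b * eucNorm c * eucNorm d +
        eucNorm a' * eucNorm (b - b') * eucNorm c * eucNorm d +
        eucNorm a' * eucNorm b' * eucNorm (c - c') * eucNorm d +
        eucNorm a' * eucNorm b' * eucNorm c' * eucNorm (d - d') := by
  have hg : 0 < θ₁ + θ₂ - E := by linarith
  -- telescoping
  have htel : pairResolvent hH E a b c d - pairResolvent hH E a' b' c' d' =
      pairResolvent hH E (a - a') b c d + pairResolvent hH E a' (b - b') c d +
        pairResolvent hH E a' b' (c - c') d + pairResolvent hH E a' b' c' (d - d') := by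
    rw [← pairResolvent_sub₁, ← pairResolvent_sub₂, ← pairResolvent_sub₃, ← pairResolvent_sub₄]
    ring
  have h1 := norm_pairResolvent_le hH p₁ p₂ hK₁ hK₂ hθ₁ hθ₂ hE (support_sub ha ha') hb hc hd
  have h2 := norm_pairResolvent_le hH p₁ p₂ hK₁ hK₂ hθ₁ hθ₂ hE ha' (support_sub hb hb') hc hd
  have h3 := norm_pairResolvent_le hH p₁ p₂ hK₁ hK₂ hθ₁ hθ₂ hE ha' hb' (support_sub hc hc') hd
  have h4 := norm_pairResolvent_le hH p₁ p₂ hK₁ hK₂ hθ₁ hθ₂ hE ha' hb' hc' (support_sub hd hd')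
  rw [htel]
  have hn := norm_add_le
    (pairResolvent hH E (a - a') b c d + pairResolvent hH E a' (b - b') c d +
      pairResolvent hH E a' b' (c - c') d) (pairResolvent hH E a' b' c' (d - d'))
  have hn' := norm_add_le (pairResolvent hH E (a - a') b c d + pairResolvent hH E a' (b - b') c d)
    (pairResolvent hH E a' b' (c - c') d)
  have hn'' := norm_add_le (pairResolvent hH E (a - a') b c d) (pairResolvent hH E a' (b - b') c d)
  nlinarith [norm_nonneg (pairResolvent hH E (a - a') b c d), norm_nonneg (pairResolvent hH E a' (b - b') c d),
    norm_nonneg (pairResolvent hH E a' b' (c - c') d), norm_nonneg (pairResolvent hH E a' b' c' (d - d'))]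

end Perturb

end Generic


/-! ### The two-step a-posteriori enclosure of a simple ground state -/

section Enclosure

variable {m : Type*} [Fintype m] [DecidableEq m]

omit [DecidableEq m] in
/-- `conj z * z = ‖z‖²`. [folklore] -/
theorem star_mul_self_eq_normSq (z : ℂ) : star z * z = ((‖z‖ ^ 2 : ℝ) : ℂ) := by
  rw [Complex.star_def, Complex.conj_mul', Complex.ofReal_pow]

omit [DecidableEq m] in
/-- `⟨φ, Hψ⟩ = λ₁ ⟨φ, ψ⟩` for a Hermitian `H` and an eigenvector `Hφ = λ₁φ` (`λ₁` real). [folklore] -/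
theorem star_dotProduct_mulVec_of_eigenvector {H : Matrix m m ℂ} (hH : H.IsHermitian) {φ : m → ℂ} {lam₁ : ℝ}
    (hHφ : H *ᵥ φ = (lam₁ : ℂ) • φ) (ψ : m → ℂ) :
    star φ ⬝ᵥ (H *ᵥ ψ) = (lam₁ : ℂ) * (star φ ⬝ᵥ ψ) := by
  have h1 : star φ ᵥ* H = (lam₁ : ℂ) • star φ := by
    have := congrArg star hHφ
    rw [star_mulVec, hH.eq, star_smul, Complex.star_def, Complex.conj_ofReal] at this
    exact this
  rw [dotProduct_mulVec, h1, smul_dotProduct, smul_eq_mul]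

omit [DecidableEq m] in
/-- **The energy step of the enclosure.** `H` Hermitian; `φ` a unit eigenvector (`Hφ = λ₁φ`) supported on the block
`p`; the DEFLATED floor `λ₂⁻ ‖u‖² ≤ Re⟨u,Hu⟩ + κ |⟨ψ,u⟩|²` on vectors supported on `p`; `ψ` supported on `p` with
`Re⟨ψ,Hψ⟩ ≤ ē ‖ψ‖²` and `λ₁ ≤ ē`. Then the defect `D = ‖ψ‖² - |⟨φ,ψ⟩|²` (squared norm of the component of `ψ`
orthogonal to `φ`) obeys `(λ₂⁻ - λ₁) D ≤ ‖ψ‖² (ē - λ₁)` — test the floor on `u = ‖ψ‖² φ - ⟨ψ,φ⟩ ψ ⟂ ψ`. [folklore] -/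
theorem defect_energy_bound {H : Matrix m m ℂ} (hH : H.IsHermitian) (p : m → Prop)
    {φ : m → ℂ} (hφp : ∀ j, ¬ p j → φ j = 0) (hφ1 : star φ ⬝ᵥ φ = 1) {lam₁ : ℝ}
    (hHφ : H *ᵥ φ = (lam₁ : ℂ) • φ) {lam₂ κ : ℝ} {ψ : m → ℂ} (hψp : ∀ j, ¬ p j → ψ j = 0)
    (hD : ∀ u : m → ℂ, (∀ j, ¬ p j → u j = 0) →
      lam₂ * (star u ⬝ᵥ u).re ≤ (star u ⬝ᵥ H *ᵥ u).re + κ * ‖star ψ ⬝ᵥ u‖ ^ 2)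
    {ebar : ℝ} (hE : (star ψ ⬝ᵥ H *ᵥ ψ).re ≤ ebar * (star ψ ⬝ᵥ ψ).re) (hlam : lam₁ ≤ ebar) :
    (lam₂ - lam₁) * (eucNorm ψ ^ 2 - ‖star φ ⬝ᵥ ψ‖ ^ 2) ≤ eucNorm ψ ^ 2 * (ebar - lam₁) := by
  set n : ℝ := eucNorm ψ ^ 2 with hn
  set γ : ℂ := star ψ ⬝ᵥ φ with hγ
  have hφψ : star φ ⬝ᵥ ψ = star γ := by
    rw [hγ, star_dotProduct]
  have hnγ : ‖star φ ⬝ᵥ ψ‖ = ‖γ‖ := by rw [hφψ, norm_star]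
  have hψψ : star ψ ⬝ᵥ ψ = (n : ℂ) := by rw [star_dotProduct_self_eq_eucNorm_sq]
  have hHψφ : star φ ⬝ᵥ (H *ᵥ ψ) = (lam₁ : ℂ) * star γ := by
    rw [star_dotProduct_mulVec_of_eigenvector hH hHφ, hφψ]
  -- the test vector `u = n φ - γ ψ`
  set u : m → ℂ := (n : ℂ) • φ - γ • ψ with hu
  have hup : ∀ j, ¬ p j → u j = 0 := fun j hj => by
    simp [hu, hφp j hj, hψp j hj]
  have hψu : star ψ ⬝ᵥ u = 0 := by
    rw [hu, dotProduct_sub, dotProduct_smul, dotProduct_smul, hψψ, smul_eq_mul, smul_eq_mul]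
    ring
  have hstarn : star ((n : ℝ) : ℂ) = (n : ℂ) := by rw [Complex.star_def, Complex.conj_ofReal]
  have huu : star u ⬝ᵥ u = (n : ℂ) ^ 2 - (n : ℂ) * (star γ * γ) := by
    rw [hu]
    simp only [star_sub, star_smul, sub_dotProduct, smul_dotProduct, dotProduct_sub, dotProduct_smul, smul_eq_mul,
      hφ1, hφψ, hψψ, hstarn]
    rw [← hγ]
    ring
  have hHu : star u ⬝ᵥ (H *ᵥ u) =
      (lam₁ : ℂ) * ((n : ℂ) ^ 2 - 2 * (n : ℂ) * (star γ * γ)) + (star γ * γ) * (star ψ ⬝ᵥ (H *ᵥ ψ)) := by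
    rw [hu]
    simp only [mulVec_sub, mulVec_smul, hHφ, star_sub, star_smul, sub_dotProduct, smul_dotProduct, dotProduct_sub,
      dotProduct_smul, smul_eq_mul, hφ1, hHψφ, hstarn]
    rw [← hγ]
    ring
  have hγγ : star γ * γ = ((‖γ‖ ^ 2 : ℝ) : ℂ) := star_mul_self_eq_normSq γ
  have huu' : (star u ⬝ᵥ u).re = n ^ 2 - n * ‖γ‖ ^ 2 := by
    rw [huu, hγγ]; push_cast; simp [Complex.mul_re, pow_two]
  have hHu' : (star u ⬝ᵥ (H *ᵥ u)).re = lam₁ * (n ^ 2 - 2 * n * ‖γ‖ ^ 2) + ‖γ‖ ^ 2 * (star ψ ⬝ᵥ (H *ᵥ ψ)).re := by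
    rw [hHu, hγγ]
    have e1 : ((lam₁ : ℂ) * ((n : ℂ) ^ 2 - 2 * (n : ℂ) * (((‖γ‖ ^ 2 : ℝ) : ℂ)))).re =
        lam₁ * (n ^ 2 - 2 * n * ‖γ‖ ^ 2) := by
      rw [show (lam₁ : ℂ) * ((n : ℂ) ^ 2 - 2 * (n : ℂ) * (((‖γ‖ ^ 2 : ℝ) : ℂ))) =
        ((lam₁ * (n ^ 2 - 2 * n * ‖γ‖ ^ 2) : ℝ) : ℂ) by push_cast; ring, Complex.ofReal_re]
    rw [Complex.add_re, e1, Complex.re_ofReal_mul]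
  -- the floor on `u`
  have hfloor := hD u hup
  rw [hψu, norm_zero, zero_pow two_ne_zero, mul_zero, add_zero, huu', hHu'] at hfloor
  have hEψ : (star ψ ⬝ᵥ H *ᵥ ψ).re ≤ ebar * n := by rwa [hψψ, Complex.ofReal_re] at hE
  have hγle : ‖γ‖ ^ 2 ≤ n := by
    have h := norm_star_dotProduct_le ψ φ
    rw [← hγ, eucNorm_eq_one hφ1, mul_one] at h
    exact pow_le_pow_left₀ (norm_nonneg _) h 2
  have hn0 : 0 ≤ n := by positivity
  rw [hnγ]
  -- `n · goal` follows from the floor; cancel `n` (the case `n = 0` forces `γ = 0`)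
  have key : n * ((lam₂ - lam₁) * (n - ‖γ‖ ^ 2)) ≤ n * (n * (ebar - lam₁)) := by
    have h2 : ‖γ‖ ^ 2 * (star ψ ⬝ᵥ H *ᵥ ψ).re ≤ ‖γ‖ ^ 2 * (ebar * n) :=
      mul_le_mul_of_nonneg_left hEψ (sq_nonneg _)
    nlinarith [mul_le_mul_of_nonneg_left hγle (by linarith : (0 : ℝ) ≤ ebar - lam₁)]
  by_cases hnpos : 0 < n
  · exact le_of_mul_le_mul_left key hnpos
  · have hn00 : n = 0 := le_antisymm (not_lt.1 hnpos) hn0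
    have hγ0 : ‖γ‖ ^ 2 = 0 := le_antisymm (hn00 ▸ hγle) (sq_nonneg _)
    rw [hn00, hγ0]; simp

omit [DecidableEq m] in
/-- **The residual step of the enclosure.** Same setting; let `w = ψ - ⟨φ,ψ⟩φ` be the component of `ψ` orthogonal
to `φ` (`‖w‖² = D`). If `‖Hψ - ρψ‖ ≤ r`, then `(λ₂⁻ - ρ - κ ‖w‖²) ‖w‖ ≤ r`: indeed `⟨ψ, w⟩ = ‖w‖²`,
`Re⟨w, Hw⟩ ≥ (λ₂⁻ - κ‖w‖²)‖w‖²` by the deflated floor, and `Re⟨w, (H-ρ)ψ⟩ = Re⟨w, Hw⟩ - ρ‖w‖² ≤ ‖w‖ r`.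
(With the energy step bounding `‖w‖²` a priori, this is the sharp, residual-order enclosure.) [folklore] -/
theorem defect_residual_bound {H : Matrix m m ℂ} (p : m → Prop)
    {φ : m → ℂ} (hφp : ∀ j, ¬ p j → φ j = 0) (hφ1 : star φ ⬝ᵥ φ = 1) {lam₁ : ℝ}
    (hHφ : H *ᵥ φ = (lam₁ : ℂ) • φ) {lam₂ κ : ℝ} {ψ : m → ℂ} (hψp : ∀ j, ¬ p j → ψ j = 0)
    (hD : ∀ u : m → ℂ, (∀ j, ¬ p j → u j = 0) →
      lam₂ * (star u ⬝ᵥ u).re ≤ (star u ⬝ᵥ H *ᵥ u).re + κ * ‖star ψ ⬝ᵥ u‖ ^ 2)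
    {ρ r : ℝ} (hres : eucNorm (H *ᵥ ψ - (ρ : ℂ) • ψ) ≤ r) :
    (lam₂ - ρ - κ * eucNorm (ψ - (star φ ⬝ᵥ ψ) • φ) ^ 2) * eucNorm (ψ - (star φ ⬝ᵥ ψ) • φ) ≤ r := by
  set γ : ℂ := star ψ ⬝ᵥ φ with hγ
  have hφψ : star φ ⬝ᵥ ψ = star γ := by
    rw [hγ, star_dotProduct]
  set w : m → ℂ := ψ - (star φ ⬝ᵥ ψ) • φ with hw
  set s : ℝ := eucNorm w with hs
  have hwp : ∀ j, ¬ p j → w j = 0 := fun j hj => by simp [hw, hφp j hj, hψp j hj]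
  have hφw : star φ ⬝ᵥ w = 0 := by
    rw [hw, dotProduct_sub, dotProduct_smul, hφ1, smul_eq_mul, mul_one, sub_self]
  have hwφ : star w ⬝ᵥ φ = 0 := by
    have := congrArg star hφw
    rwa [star_dotProduct, star_star, star_zero] at this
  have hww : star w ⬝ᵥ w = ((s ^ 2 : ℝ) : ℂ) := by rw [hs, star_dotProduct_self_eq_eucNorm_sq]
  -- `⟨ψ, w⟩ = ‖w‖²`
  have hψw : star ψ ⬝ᵥ w = ((s ^ 2 : ℝ) : ℂ) := by
    have : ψ = w + (star φ ⬝ᵥ ψ) • φ := by rw [hw]; abel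
    conv_lhs => rw [this]
    rw [star_add, add_dotProduct, hww, star_smul, smul_dotProduct, hφw, smul_zero, add_zero]
  -- `⟨w, Hψ⟩ = ⟨w, Hw⟩`
  have hwHψ : star w ⬝ᵥ (H *ᵥ ψ) = star w ⬝ᵥ (H *ᵥ w) := by
    have : ψ = w + (star φ ⬝ᵥ ψ) • φ := by rw [hw]; abel
    conv_lhs => rw [this]
    rw [mulVec_add, mulVec_smul, hHφ, dotProduct_add, dotProduct_smul, dotProduct_smul, hwφ, smul_zero, smul_zero,
      add_zero]
  -- the floor on `w`
  have hfloor := hD w hwp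
  rw [hψw, hww, Complex.ofReal_re, Complex.norm_real, Real.norm_of_nonneg (sq_nonneg _)] at hfloor
  -- `Re⟨w, (H-ρ)ψ⟩ ≤ ‖w‖ r`
  have hcs : (star w ⬝ᵥ (H *ᵥ ψ - (ρ : ℂ) • ψ)).re ≤ s * r := by
    have h := norm_star_dotProduct_le w (H *ᵥ ψ - (ρ : ℂ) • ψ)
    have h' := (Complex.re_le_norm _).trans h
    rw [← hs] at h'
    exact h'.trans (mul_le_mul_of_nonneg_left hres (eucNorm_nonneg _))
  have hwψ : star w ⬝ᵥ ψ = ((s ^ 2 : ℝ) : ℂ) := by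
    have := congrArg star hψw
    rwa [star_dotProduct, star_star, Complex.star_def, Complex.conj_ofReal] at this
  rw [dotProduct_sub, dotProduct_smul, hwHψ, hwψ, Complex.sub_re, smul_eq_mul, ← Complex.ofReal_mul,
    Complex.ofReal_re] at hcs
  -- combine: (lam₂ - ρ - κ s²) s² ≤ s r, then cancel `s`
  have key : (lam₂ - ρ - κ * s ^ 2) * s ^ 2 ≤ s * r := by nlinarith
  have hs0 : 0 ≤ s := eucNorm_nonneg _
  by_cases hspos : 0 < s
  · have : (lam₂ - ρ - κ * s ^ 2) * s * s ≤ r * s := by nlinarith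
    exact le_of_mul_le_mul_right this hspos
  · have hs00 : s = 0 := le_antisymm (not_lt.1 hspos) hs0
    rw [hs00, mul_zero]
    -- `r ≥ 0` from the residual hypothesis
    exact (eucNorm_nonneg _).trans hres

omit [DecidableEq m] in
/-- `‖w‖² = ‖ψ‖² - |⟨φ,ψ⟩|²` for the component `w = ψ - ⟨φ,ψ⟩φ` of `ψ` orthogonal to a unit vector `φ`, and
`|⟨φ,ψ⟩|² ≤ ‖ψ‖²`. [folklore] -/
theorem eucNorm_sub_proj_sq {φ : m → ℂ} (hφ1 : star φ ⬝ᵥ φ = 1) (ψ : m → ℂ) :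
    eucNorm (ψ - (star φ ⬝ᵥ ψ) • φ) ^ 2 = eucNorm ψ ^ 2 - ‖star φ ⬝ᵥ ψ‖ ^ 2 := by
  set c : ℂ := star φ ⬝ᵥ ψ with hc
  have hψφ : star ψ ⬝ᵥ φ = star c := by rw [hc, star_dotProduct]
  have h : star (ψ - c • φ) ⬝ᵥ (ψ - c • φ) = star ψ ⬝ᵥ ψ - star c * c := by
    simp only [star_sub, star_smul, sub_dotProduct, smul_dotProduct, dotProduct_sub, dotProduct_smul, smul_eq_mul,
      hφ1, hψφ]
    rw [← hc]
    ring
  have := congrArg Complex.re h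
  rw [← eucNorm_sq, star_dotProduct_self_eq_eucNorm_sq, star_mul_self_eq_normSq, Complex.sub_re,
    Complex.ofReal_re, Complex.ofReal_re] at this
  exact this

end Enclosure

/-! ### Registered sub-goal of the crux item (stmt-HubbardSuperconductivity-8148) -/

set_option linter.style.longLine false in
/-- Registered sub-goal `dressHalfFilled_fermionNormLe` of the crux item (closed, `Type`-level): `‖c_i v‖ ≤ ‖v‖` and
`‖c†_i v‖ ≤ ‖v‖` (the landed `DeformationLadder.ss_eucNorm_annihilation_mulVec_le`, `SgAnchorFreeze.eucNorm_creation_mulVec_le`). [folklore] -/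
theorem dressHalfFilled_fermionNormLe : ∀ {ι : Type} [LinearOrder ι] [Fintype ι] (i : ι) (v : Literature.MathematicalPhysics.QuantumLattice.Fock ι), Literature.MathematicalPhysics.QuantumLattice.eucNorm (Matrix.mulVec (Literature.MathematicalPhysics.QuantumLattice.annihilation i) v) ≤ Literature.MathematicalPhysics.QuantumLattice.eucNorm v ∧ Literature.MathematicalPhysics.QuantumLattice.eucNorm (Matrix.mulVec (Literature.MathematicalPhysics.QuantumLattice.creation i) v) ≤ Literature.MathematicalPhysics.QuantumLattice.eucNorm v :=
  fun i v =>
    ⟨Summit.HubbardSuperconductivity.HubbardSuperconductivity.Theorems.DeformationLadder.ss_eucNorm_annihilation_mulVec_le i v,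
      Summit.HubbardSuperconductivity.HubbardSuperconductivity.Theorems.SgAnchorFreeze.eucNorm_creation_mulVec_le i v⟩

end Summit.HubbardSuperconductivity.HubbardSuperconductivity.Theorems.LevyLogBootstrap

end
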